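import Literature.MathematicalPhysics.KineticTheory.HardSphereCampbellEngine
import HarnessLib

/-!
# The sharp one-window bounds of the Campbell identity

Inputs of the discharge of the stationary collision-rate (Campbell / special-flow) identity
`HardSphereCampbellFormula` (Cercignani–Illner–Pulvirenti 1994, App. 4.A). From the engine
`lintegral_hitPiece_eq_cylinder` (a GST hit piece in pre-collision cylinder coordinates over the
window `(0, δ]`) and the kinematics of the backward flight:

* `campbell_volume_hitPiece_shell_le` — `vol(hit(a,b) ∩ {E ≤ V²/2}) ≤ δ · Flux_{ab}(1_{E ≤ V²/2})`
  (the one-window volume bound consumed by the sharp collision-count bound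
  `lintegral_ncard_collisionTimes_le_of_hitPiece_volume`, hence by the UPPER bound);
* `campbell_lintegral_hitPiece_shell_ge` —
  `∫_{hit(a,b) ∩ shell} H(w⁺(u)) du ≥ δ · ∫ dz ∫ dω ε^{d-1}⟪ω, v_a − v_b⟫ (1_{E ≤ V²/2, others > ε + 2r} H)(z^{ab}_ω)`
  (consumed by the LOWER bound).

## References

* C. Cercignani, R. Illner, M. Pulvirenti, *The Mathematical Theory of Dilute Gases*, Springer
  (1994), §4.2, App. 4.A pp. 107–111.
* I. Gallagher, L. Saint-Raymond, B. Texier, *From Newton to Boltzmann*, EMS (2013), proof of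
  Prop. 4.1.1 p. 19.
-/

open MeasureTheory Set Function Filter Metric
open scoped ENNReal NNReal RealInnerProductSpace

namespace Literature.MathematicalPhysics.KineticTheory

open Literature.Analysis.FluidPDE

noncomputable section

variable {d : Type*} [Fintype d] {N : ℕ} {ε : ℝ}

/-- **The sharp one-window volume bound**: for `ε > 0`, `ε + 2r < 1/2`, `2Vδ ≤ r`, `V, δ ≥ 0` and
`a ≠ b`, the Lebesgue measure of the hit piece of `(a, b)` on the energy shell is at most `δ` times
the outgoing contact flux of the shell through `Σ_{ab}`:
`vol(hit(a,b) ∩ {E ≤ V²/2}) ≤ δ · ∫ dz ∫ dω ε^{d-1}⟪ω, v_a − v_b⟫₊ 1_{D_ε}(z^{ab}_ω) 1_{E(z^{ab}_ω) ≤ V²/2}`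
(the engine with `H = 1`, and `S_{-τ} collide z^{ab}_ω ∈ hit ∩ shell ⇒ z^{ab}_ω ∈ D_ε ∩ shell`).
[cite: CIP1994, App. 4.A pp. 107–111] -/
theorem campbell_volume_hitPiece_shell_le {r δ V : ℝ} (hε : 0 < ε) (hch : ε + 2 * r < 2⁻¹)
    (hr : 2 * V * δ ≤ r) (hV : 0 ≤ V) (hδ : 0 ≤ δ) {a b : Fin N} (hab : a ≠ b) :
    volume (Alexander.hitPiece N ε r δ a b ∩
        {u : Config N d (UnitAddTorus d) | configEnergy u ≤ V ^ 2 / 2}) ≤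
      ENNReal.ofReal δ *
        ∫⁻ z : Config N d (UnitAddTorus d), ∫⁻ ω : Metric.sphere (0 : EuclideanSpace ℝ d) 1,
          ENNReal.ofReal (ε ^ (Fintype.card d - 1) * ⟪((ω : EuclideanSpace ℝ d)), (z a).2 - (z b).2⟫) *
            (hardSphereDomain (Torus.geometry d) N ε).indicator
              (fun w => if configEnergy w ≤ V ^ 2 / 2 then (1 : ℝ≥0∞) else 0)
              (contactInsert ε a b (ω : EuclideanSpace ℝ d) z)
          ∂(volume : Measure (EuclideanSpace ℝ d)).toSphere := by
  have hε2 : ε < 1 / 2 := by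
    have hr0 : 0 ≤ r := le_trans (by positivity) hr
    linarith
  set S := Alexander.hitPiece N ε r δ a b ∩
    {u : Config N d (UnitAddTorus d) | configEnergy u ≤ V ^ 2 / 2} with hSdef
  have hS : MeasurableSet S :=
    (Alexander.measurableSet_hitPiece ε r δ a b).inter (Alexander.measurableSet_energyShell _)
  have h := lintegral_hitPiece_eq_cylinder (d := d) hε hch hr hV hδ hab
    (measurable_const : Measurable fun _ : Config N d (UnitAddTorus d) => (1 : ℝ≥0∞))
  beta_reduce at h
  -- the pointwise bound of the window-cut cylinder integrand by the shell flux integrand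
  have hpt : ∀ (z : Config N d (UnitAddTorus d)) (ω : Metric.sphere (0 : EuclideanSpace ℝ d) 1) (τ : ℝ),
      τ ∈ Ioc (0 : ℝ) δ →
      ENNReal.ofReal (ε ^ (Fintype.card d - 1) * ⟪((ω : EuclideanSpace ℝ d)), (z a).2 - (z b).2⟫) *
          S.indicator (fun _ => (1 : ℝ≥0∞))
            (freeFlight (Torus.geometry d) (-τ)
              (collidePair (Torus.geometry d) a b (contactInsert ε a b (ω : EuclideanSpace ℝ d) z))) * 1 ≤
        ENNReal.ofReal (ε ^ (Fintype.card d - 1) * ⟪((ω : EuclideanSpace ℝ d)), (z a).2 - (z b).2⟫) *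
          (hardSphereDomain (Torus.geometry d) N ε).indicator
            (fun w => if configEnergy w ≤ V ^ 2 / 2 then (1 : ℝ≥0∞) else 0)
            (contactInsert ε a b (ω : EuclideanSpace ℝ d) z) := by
    intro z ω τ hτ
    rw [mul_one]
    by_cases hy : freeFlight (Torus.geometry d) (-τ)
        (collidePair (Torus.geometry d) a b (contactInsert ε a b (ω : EuclideanSpace ℝ d) z)) ∈ S
    · obtain ⟨hD, hE⟩ := campbell_contact_mem_of_back_mem_hitPiece hε.le hε2 hab hr hV ω z hτ hy
      rw [indicator_of_mem hy, indicator_of_mem hD, if_pos hE]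
    · rw [indicator_of_notMem hy, mul_zero]
      exact bot_le
  calc volume S = ∫⁻ u, S.indicator (fun _ => (1 : ℝ≥0∞)) u := (lintegral_indicator_one hS).symm
    _ = _ := h
    _ ≤ ∫⁻ z : Config N d (UnitAddTorus d), ∫⁻ ω : Metric.sphere (0 : EuclideanSpace ℝ d) 1,
          ∫⁻ _ in Ioc (0 : ℝ) δ,
            ENNReal.ofReal (ε ^ (Fintype.card d - 1) * ⟪((ω : EuclideanSpace ℝ d)), (z a).2 - (z b).2⟫) *
              (hardSphereDomain (Torus.geometry d) N ε).indicator
                (fun w => if configEnergy w ≤ V ^ 2 / 2 then (1 : ℝ≥0∞) else 0)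
                (contactInsert ε a b (ω : EuclideanSpace ℝ d) z)
          ∂volume ∂(volume : Measure (EuclideanSpace ℝ d)).toSphere :=
        lintegral_mono fun z => lintegral_mono fun ω =>
          setLIntegral_mono' measurableSet_Ioc fun τ hτ => hpt z ω τ hτ
    _ = ∫⁻ z : Config N d (UnitAddTorus d), ∫⁻ ω : Metric.sphere (0 : EuclideanSpace ℝ d) 1,
          ENNReal.ofReal (ε ^ (Fintype.card d - 1) * ⟪((ω : EuclideanSpace ℝ d)), (z a).2 - (z b).2⟫) *
            (hardSphereDomain (Torus.geometry d) N ε).indicator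
              (fun w => if configEnergy w ≤ V ^ 2 / 2 then (1 : ℝ≥0∞) else 0)
              (contactInsert ε a b (ω : EuclideanSpace ℝ d) z) * ENNReal.ofReal δ
          ∂(volume : Measure (EuclideanSpace ℝ d)).toSphere := by
        refine lintegral_congr fun z => lintegral_congr fun ω => ?_
        rw [setLIntegral_const, Real.volume_Ioc, sub_zero]
    _ = (∫⁻ z : Config N d (UnitAddTorus d), ∫⁻ ω : Metric.sphere (0 : EuclideanSpace ℝ d) 1,
          ENNReal.ofReal (ε ^ (Fintype.card d - 1) * ⟪((ω : EuclideanSpace ℝ d)), (z a).2 - (z b).2⟫) *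
            (hardSphereDomain (Torus.geometry d) N ε).indicator
              (fun w => if configEnergy w ≤ V ^ 2 / 2 then (1 : ℝ≥0∞) else 0)
              (contactInsert ε a b (ω : EuclideanSpace ℝ d) z)
          ∂(volume : Measure (EuclideanSpace ℝ d)).toSphere) * ENNReal.ofReal δ := by
        rw [← lintegral_mul_const' _ _ ENNReal.ofReal_ne_top]
        exact lintegral_congr fun z => lintegral_mul_const' _ _ ENNReal.ofReal_ne_top
    _ = _ := mul_comm _ _

/-- **The sharp one-window lower bound**: for `ε > 0`, `ε + 2r < 1/2`, `2Vδ ≤ r`, `V, δ ≥ 0`,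
`a ≠ b` and a measurable mark `H ≥ 0`, the Lebesgue integral over the hit piece of `(a, b)` (on the
energy shell) of `H` read on the post-collisional configuration is at least `δ` times the outgoing
contact flux of `H` restricted to contact configurations on the shell all of whose OTHER pairs are
farther than `ε + 2r` (the engine, and for such a contact configuration every backward flight
`S_{-τ} collide z^{ab}_ω`, `0 < τ ≤ δ`, lies in the hit piece on the shell).
[cite: CIP1994, App. 4.A pp. 107–111] -/
theorem campbell_lintegral_hitPiece_shell_ge {r δ V : ℝ} (hε : 0 < ε) (hch : ε + 2 * r < 2⁻¹)
    (hr : 2 * V * δ ≤ r) (hV : 0 ≤ V) (hδ : 0 ≤ δ) {a b : Fin N} (hab : a ≠ b)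
    {H : Config N d (UnitAddTorus d) → ℝ≥0∞} (hH : Measurable H) :
    ENNReal.ofReal δ *
        ∫⁻ z : Config N d (UnitAddTorus d), ∫⁻ ω : Metric.sphere (0 : EuclideanSpace ℝ d) 1,
          ENNReal.ofReal (ε ^ (Fintype.card d - 1) * ⟪((ω : EuclideanSpace ℝ d)), (z a).2 - (z b).2⟫) *
            {w : Config N d (UnitAddTorus d) | configEnergy w ≤ V ^ 2 / 2 ∧
                Alexander.OthersFar ε (2 * r) w a b}.indicator H
              (contactInsert ε a b (ω : EuclideanSpace ℝ d) z)
          ∂(volume : Measure (EuclideanSpace ℝ d)).toSphere ≤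
      ∫⁻ u : Config N d (UnitAddTorus d),
        (Alexander.hitPiece N ε r δ a b ∩ {u | configEnergy u ≤ V ^ 2 / 2}).indicator
          (fun u => H (collidePair (Torus.geometry d) a b
            (freeFlight (Torus.geometry d)
              (pairHitTime ε ((Torus.geometry d).sepVec (u a).1 (u b).1) ((u a).2 - (u b).2)) u))) u := by
  set S := Alexander.hitPiece N ε r δ a b ∩
    {u : Config N d (UnitAddTorus d) | configEnergy u ≤ V ^ 2 / 2} with hSdef
  set T := {w : Config N d (UnitAddTorus d) | configEnergy w ≤ V ^ 2 / 2 ∧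
    Alexander.OthersFar ε (2 * r) w a b} with hTdef
  rw [lintegral_hitPiece_eq_cylinder (d := d) hε hch hr hV hδ hab hH]
  -- the pointwise bound
  have hpt : ∀ (z : Config N d (UnitAddTorus d)) (ω : Metric.sphere (0 : EuclideanSpace ℝ d) 1) (τ : ℝ),
      τ ∈ Ioc (0 : ℝ) δ →
      ENNReal.ofReal (ε ^ (Fintype.card d - 1) * ⟪((ω : EuclideanSpace ℝ d)), (z a).2 - (z b).2⟫) *
          T.indicator H (contactInsert ε a b (ω : EuclideanSpace ℝ d) z) ≤
        ENNReal.ofReal (ε ^ (Fintype.card d - 1) * ⟪((ω : EuclideanSpace ℝ d)), (z a).2 - (z b).2⟫) *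
          S.indicator (fun _ => (1 : ℝ≥0∞))
            (freeFlight (Torus.geometry d) (-τ)
              (collidePair (Torus.geometry d) a b (contactInsert ε a b (ω : EuclideanSpace ℝ d) z))) *
          H (contactInsert ε a b (ω : EuclideanSpace ℝ d) z) := by
    intro z ω τ hτ
    rcases le_or_gt ⟪((ω : EuclideanSpace ℝ d)), (z a).2 - (z b).2⟫ 0 with hle | hflux
    · have h0 : ENNReal.ofReal (ε ^ (Fintype.card d - 1) * ⟪((ω : EuclideanSpace ℝ d)), (z a).2 - (z b).2⟫) = 0 :=
        ENNReal.ofReal_of_nonpos (mul_nonpos_iff.2 (Or.inl ⟨pow_nonneg hε.le _, hle⟩))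
      rw [h0, zero_mul, zero_mul, zero_mul]
    · by_cases hT : contactInsert ε a b (ω : EuclideanSpace ℝ d) z ∈ T
      · have hy := campbell_back_mem_hitPiece_of_contact hε hch hr hV hab ω z hτ hT.1 hT.2 hflux
        rw [indicator_of_mem hT, indicator_of_mem hy, mul_one]
      · rw [indicator_of_notMem hT, mul_zero]
        exact bot_le
  calc ENNReal.ofReal δ * ∫⁻ z : Config N d (UnitAddTorus d), ∫⁻ ω : Metric.sphere (0 : EuclideanSpace ℝ d) 1,
          ENNReal.ofReal (ε ^ (Fintype.card d - 1) * ⟪((ω : EuclideanSpace ℝ d)), (z a).2 - (z b).2⟫) *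
            T.indicator H (contactInsert ε a b (ω : EuclideanSpace ℝ d) z)
          ∂(volume : Measure (EuclideanSpace ℝ d)).toSphere
      = ∫⁻ z : Config N d (UnitAddTorus d), ∫⁻ ω : Metric.sphere (0 : EuclideanSpace ℝ d) 1,
          ENNReal.ofReal (ε ^ (Fintype.card d - 1) * ⟪((ω : EuclideanSpace ℝ d)), (z a).2 - (z b).2⟫) *
            T.indicator H (contactInsert ε a b (ω : EuclideanSpace ℝ d) z) * ENNReal.ofReal δ
          ∂(volume : Measure (EuclideanSpace ℝ d)).toSphere := by
        rw [mul_comm, ← lintegral_mul_const' _ _ ENNReal.ofReal_ne_top]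
        exact lintegral_congr fun z => (lintegral_mul_const' _ _ ENNReal.ofReal_ne_top).symm
    _ = ∫⁻ z : Config N d (UnitAddTorus d), ∫⁻ ω : Metric.sphere (0 : EuclideanSpace ℝ d) 1,
          ∫⁻ _ in Ioc (0 : ℝ) δ,
            ENNReal.ofReal (ε ^ (Fintype.card d - 1) * ⟪((ω : EuclideanSpace ℝ d)), (z a).2 - (z b).2⟫) *
              T.indicator H (contactInsert ε a b (ω : EuclideanSpace ℝ d) z)
          ∂volume ∂(volume : Measure (EuclideanSpace ℝ d)).toSphere := by
        refine lintegral_congr fun z => lintegral_congr fun ω => ?_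
        rw [setLIntegral_const, Real.volume_Ioc, sub_zero]
    _ ≤ _ := lintegral_mono fun z => lintegral_mono fun ω =>
          setLIntegral_mono' measurableSet_Ioc fun τ hτ => hpt z ω τ hτ

end

end Literature.MathematicalPhysics.KineticTheory
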